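import Summits.BirchSwinnertonDyer.BirchSwinnertonDyer.Theses.SignedLowerHalves
import Summits.BirchSwinnertonDyer.BirchSwinnertonDyer.Theorems.SignedLowerHalvesKobayashiLowerHalfLargeImageFWLocusAllRanks
import Summits.BirchSwinnertonDyer.Rank1Residual.Supersingular.KobayashiMainConjecture
import Summits.BirchSwinnertonDyer.Rank1Residual.Supersingular.KobayashiMainConjectureX7FouquetWan
import Literature.NumberTheory.EllipticCurves.Fouquet2025.CongruenceTransportAnyReduction
import Literature.NumberTheory.DiophantineGeometry.TateAlgorithm
import Literature.NumberTheory.EllipticCurves.Tamagawa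

/-!
# Line `shadow-seed` — crux `KobayashiLowerHalfLargeImage` (item stmt-BirchSwinnertonDyer-19001)

crux-ideate k1 g18 (planner). D-0152: this feeds the CLASS route `SignedLowerHalves`; BSD is NOT proved
here; nothing below closes the crux. NOT the line of record (that is `Lines/kurihara_rigidity.lean`, lead
seated) — published with `ledger crux write` only (W-79), never `skeleton check`ed.

IDEA (the «unipotent shadow»). Off the Fouquet–Wan locus (no multiplicative prime `ℓ` with `E[p]|G_ℓ`
ramified and `μ ≠ 1`) the mod-`p` representation of an X7 curve can still carry the EXACT residual shape
that Fouquet–Wan 2021 Thm 5.1 asks for — at an ADDITIVE prime. This happens iff `p ∣ e_q` for a tame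
potentially-good prime `q`, which for `E/ℚ` forces `p = 3` and Kodaira type `IV`/`IV*` (`e_q = 3`): then
`ρ̄_{E,3}(I_q)` is a non-trivial UNIPOTENT group of order 3, `E[3]|G_q ≅ (μω ∗; 0 μ)` with `μ` unramified
quadratic, and `μ ≠ 1` is read off the Tamagawa number (`c_q = 3` if `q ≡ 2 (3)`, `c_q = 1` if
`q ≡ 1 (3)`; proof: `Φ_q(𝔽̄_q)[3] ≅ E[3]^{I_q}` as Frobenius modules). The Serre conductor of `ρ̄` has
`q¹` exactly, so the level-lowered newform `g` (Ribet/Diamond, trivial character by Carayol at `ℓ = 3`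
under `Surj`) is Steinberg ⊗ `μ` at `q`, i.e. `g` LIES ON the FW locus although `f_E` does not; FW21
Thm 5.1 (hypotheses are on `ρ̄` only, plus `q ∥ N_g`) gives Kato's IMC for `g`; Fouquet 2025 Thm 4.1
(1) ⇒ (2) (published) transports the zeta-ISOMORPHISM from the motivic point `λ_g` to EVERY motivic point
of `T^Σ_{𝔪ρ̄}`, in particular to `λ_{f_E}` (a different irreducible component at `q`: supercuspidal /
principal-series type vs Steinberg type — all formally smooth at a ramified non-scalar `ρ̄|G_q` by
Shotton 2016 Prop 5.6 (2a) / 5.8 (1), so Fouquet's Prop 3.5 applies with `U_q` arbitrary), under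
Fouquet's Ass. 2.9 (⟸ `Surj W 3`, `a_3 = 0`) and Ass. 3.4 at the `ρ̄`-unramified level primes
(= `Assumption34TateAt 3 W`); Kobayashi 2003 Thm 7.4 turns Kato's IMC into both signed IMCs.

STUBS (3) + kernel-checked composition `KobayashiLowerHalfLargeImage_of`. Sorries ONLY in `stub_*`.
* `stub_fwLocus`       — the FW locus slice (all `p`); closed MODULO the route binder (`stub_fwLocus_of_OPEN`).
* `stub_shadowThree`   — NEW: the shadow slice at `p = 3`; closed MODULO the composite binder
                         `ShadowSeedTransport_OPEN` (`stub_shadowThree_of_OPEN`), whose only non-published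
                         link is FW21 Thm 5.1 (PRE) — the SAME epistemic status as the locus slice.
* `stub_offLocusRest`  — the honest residual: off-locus pairs without (p = 3 ∧ shadow ∧ A34). OPEN, no
                         engine in print (dossier §2; lines kurihara-rigidity / unitseed-fouquet attack it).
Census (cell window N ≤ 500 000, X7 × {a_p = 0}, p = 3, `Surj`): 150 locus pairs; 69 off-locus, of which
26 have a shadow prime AND pass `Assumption34TateAt 3` (all 26 rank 1; 4 of the 6 «shapeless» no-mult
pairs among them: 16900r1, 19600dd1, 222784n1, 379456el1). For `p ≥ 5` no shadow exists (additive inertia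
acts semisimply mod `p`), so this line is a `p = 3` engine by nature (feeds the lead's proposed C2
`KobayashiLowerHalfLargeImageThree`).
-/

set_option autoImplicit false
set_option linter.dupNamespace false

noncomputable section

open scoped Classical

open WeierstrassCurve Literature.NumberTheory.EllipticCurves
  Literature.NumberTheory.EllipticCurves.Rank1Residual
  Literature.NumberTheory.EllipticCurves.Fouquet2025
  Literature.NumberTheory.DiophantineGeometry
  Summit.BirchSwinnertonDyer.Rank1Residual.Supersingular
  Summit.BirchSwinnertonDyer.BirchSwinnertonDyer.Theorems

namespace Summit.BirchSwinnertonDyer.BirchSwinnertonDyer.Cruxes.KobayashiLowerHalfLargeImage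

namespace ShadowSeed

/-! ## Objects -/

/-- A **shadow prime** of `W` (for `p = 3`): a prime `q ≠ 3` of Kodaira type `IV` with `v_q(Δ_min) = 4`
or `IV*` with `v_q(Δ_min) = 8` (additive, potentially good, TAME with `e_q = 3`; the valuation clause is
automatic for `q ≥ 5` and means `f_2 = 2` at `q = 2`), whose mod-3 shadow is NON-SPLIT:
`c_q = 3` if `q ≡ 2 (mod 3)`, `c_q = 1` if `q ≡ 1 (mod 3)` — equivalently `E[3]|G_{ℚ_q} ≅ (μω ∗; 0 μ)`
with `∗ ≠ 0` unipotent-inertial and `μ = η_q ≠ 1` the unramified quadratic character, which is hypothesis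
(H3) of Fouquet–Wan 2021 Thm 5.1 at `ℓ = q` (in FW's cohomological normalisation `E[3]^∨ ≅ E[3] ⊗ ω⁻¹`:
sub `μ`, quotient `μχ_cyc⁻¹`, ramified). Decidable by Tate's algorithm. -/
def IsShadowPrimeAt (W : WeierstrassCurve ℚ) [W.IsElliptic] [W.IsGloballyMinimal] (q : ℕ)
    [Fact q.Prime] : Prop :=
  q ≠ 3 ∧
  (((W.baseChange ℚ_[q]).kodairaSymbol ℤ_[q] = KodairaSymbol.IV ∧
      padicValInt q W.minimalDiscriminantInt = 4) ∨
    ((W.baseChange ℚ_[q]).kodairaSymbol ℤ_[q] = KodairaSymbol.IVstar ∧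
      padicValInt q W.minimalDiscriminantInt = 8)) ∧
  (W.baseChange ℚ_[q]).localTamagawaNumber ℤ_[q] = (if q % 3 = 2 then 3 else 1)

/-- `W` has at least one shadow prime. -/
def HasShadow (W : WeierstrassCurve ℚ) [W.IsElliptic] [W.IsGloballyMinimal] : Prop :=
  ∃ (q : ℕ) (_ : Fact q.Prime), IsShadowPrimeAt W q

/-- The Fouquet–Wan locus clause of the route binder `FouquetWan2021_thm51_via_kobayashi74_OPEN`, verbatim:
a prime `ℓ ≠ p` of non-split multiplicative reduction with `p ∤ ord_ℓ(Δ_min)`. -/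
abbrev OnFwLocus (W : WeierstrassCurve ℚ) [W.IsElliptic] [W.IsGloballyMinimal] (p : ℕ) : Prop :=
  ∃ (ℓ : ℕ) (_ : Fact ℓ.Prime), ℓ ≠ p ∧ W.HasMultiplicativeReductionAtPrime ℓ ∧
    ¬ W.HasSplitMultiplicativeReductionAtPrime ℓ ∧ ¬ p ∣ padicValInt ℓ W.minimalDiscriminantInt

/-- **Composite OPEN binder of the line (± currency, as the route's own binder).** «Diamond 1995 Thm 1.1 +
Carayol (PUB; tree fact `Literature.NumberTheory.Automorphic.diamond1995_refinedSerre` gives the newform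
`g` of weight 2 and level `M ∣ N(ρ̄)` with `q ∥ M`, `3 ∤ M`, `ρ̄_g ≅ E[3]`; trivial character because
`Surj W 3` makes `ρ̄|G_{ℚ(√−3)}` absolutely irreducible) ∘ Fouquet–Wan 2021 Thm 5.1 at `(g, 𝔭 ∣ 3)` (PRE,
arXiv:2107.13726 §5.1: `p ≥ 3`; `ρ̄` abs. irreducible; `(ρ̄|G_3)^{ss} ≠ χ ⊕ χ_cyc χ` since `a_3 = 0`;
(H3) at `ℓ = q` = the shadow, `μ ≠ 1`; `q ∥ M`; conclusion: the zeta morphism of `T(g)_Iw` is an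
isomorphism) ∘ Fouquet 2025 Thm 4.1 (1) ⇒ (2) (PUB, arXiv:2501.07105 = Tunis. J. Math. 2025: `Σ = primes
of 3·N_W`, `U_q` small; Ass. 2.9 ⟸ `Surj W 3` and `ρ̄|G_3` irreducible; Ass. 3.4 is a condition only at
`Σ ∖ Σ(ρ̄)` = the `ρ̄`-unramified Tate primes = `Assumption34TateAt 3 W`; Prop 3.5 (3) at `q` ⟸ Shotton
2016 Prop 5.6 (2a) (`q ≡ 2 mod 3`) / Prop 5.8 (1) (`q ≡ 1 mod 3`): every fixed-type framed deformation
ring of a ramified non-scalar `ρ̄|G_q` is formally smooth) ∘ Kobayashi 2003 Thm 7.4 (PUB, `a_3 = 0`)».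
NEVER cite this `Prop` as a theorem. [claim: FouquetWan2021, status: under-review]
[cite: Fouquet2025, Thm. 4.1 and Ass. 2.9/3.4, Prop. 3.5] [cite: Diamond1995RefinedSerre, Thm. 1.1]
[cite: Shotton2016, Prop. 5.6 and 5.8] [cite: Kobayashi2003, Thm. 7.4 (p. 13)] -/
def ShadowSeedTransport_OPEN : Prop :=
  ∀ (W : WeierstrassCurve ℚ) [W.IsElliptic] [W.IsGloballyMinimal],
    W.HasGoodReductionAtPrime 3 → W.frobeniusTrace 3 = 0 → Surj W 3 →
    HasShadow W → Assumption34TateAt 3 W →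
    ∀ ε : ℤˣ, KobayashiMainConjecture W 3 ε

/-! ## Stub signatures -/

/-- Slice A: the Fouquet–Wan locus (every `p`), verbatim the crux binders + `OnFwLocus`. -/
abbrev Sig.stub_fwLocus : Prop :=
  ∀ (W : WeierstrassCurve ℚ) [W.IsElliptic] [W.IsGloballyMinimal] (p : ℕ) [Fact p.Prime],
    p ≠ 2 → ClassX7 W p → ¬ W.HasCM → W.frobeniusTrace p = 0 → Surj W p → OnFwLocus W p →
    ∃ ε : ℤˣ, KobayashiLowerDivisibility W p ε

/-- Slice B (NEW): `p = 3`, a shadow prime, Fouquet-eligible Tate primes. -/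
abbrev Sig.stub_shadowThree : Prop :=
  ∀ (W : WeierstrassCurve ℚ) [W.IsElliptic] [W.IsGloballyMinimal],
    ClassX7 W 3 → ¬ W.HasCM → W.frobeniusTrace 3 = 0 → Surj W 3 →
    HasShadow W → Assumption34TateAt 3 W →
    ∃ ε : ℤˣ, KobayashiLowerDivisibility W 3 ε

/-- Slice C (the honest residual): off the FW locus and outside slice B. No engine in print. -/
abbrev Sig.stub_offLocusRest : Prop :=
  ∀ (W : WeierstrassCurve ℚ) [W.IsElliptic] [W.IsGloballyMinimal] (p : ℕ) [Fact p.Prime],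
    p ≠ 2 → ClassX7 W p → ¬ W.HasCM → W.frobeniusTrace p = 0 → Surj W p → ¬ OnFwLocus W p →
    ¬ (p = 3 ∧ HasShadow W ∧ Assumption34TateAt 3 W) →
    ∃ ε : ℤˣ, KobayashiLowerDivisibility W p ε

/-! ## Registered-shape stubs (sorries live ONLY here) -/

/-- STUB A — OPEN as stated (its closure needs FW21 Thm 5.1, PRE); see `stub_fwLocus_of_OPEN`. -/
theorem stub_fwLocus : Sig.stub_fwLocus := by
  sorry

/-- STUB B — OPEN as stated (closure needs the composite binder, one PRE link); see
`stub_shadowThree_of_OPEN`. Size L to discharge in the tree: type Carayol's trivial-character refinement,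
the forms-level FW 5.1, Fouquet 4.1 (1)⇒(2) for a supersingular target point, and the local lemma
«shadow ⇒ (H3)»; the four literature inputs are PUB/PUB/PUB/PRE. -/
theorem stub_shadowThree : Sig.stub_shadowThree := by
  sorry

/-- STUB C — the residual; OPEN, engine-less (dossier DOSSIER-19001 §2: split-only 36-ish at p = 3 after
removing the 26 shadow pairs, all off-locus pairs at p ≥ 5, the ns-unramified pair 209814d1). -/
theorem stub_offLocusRest : Sig.stub_offLocusRest := by
  sorry

/-! ## Conditional closures (no sorry) -/

/-- Slice A MODULO the route binder (tree theorem `stub_fwLocus_of_thm51_OPEN`). CONDITIONAL. -/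
theorem stub_fwLocus_of_OPEN (hFW : FouquetWan2021_thm51_via_kobayashi74_OPEN) : Sig.stub_fwLocus :=
  fun W _ _ p _ hp hX hcm hap hs hloc => stub_fwLocus_of_thm51_OPEN hFW W p hp hX hcm hap hs hloc

/-- Slice B MODULO the composite binder `ShadowSeedTransport_OPEN`. CONDITIONAL; closes nothing. -/
theorem stub_shadowThree_of_OPEN (h : ShadowSeedTransport_OPEN) : Sig.stub_shadowThree :=
  fun W _ _ hX _ hap hs hq h34 =>
    ⟨1, kobayashiLowerDivisibility_of_mainConjecture (h W hX.1.1 hap hs hq h34 1)⟩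

/-! ## Composition (kernel-checked, no sorry): the three slices cover the crux -/

theorem KobayashiLowerHalfLargeImage_of (hA : Sig.stub_fwLocus) (hB : Sig.stub_shadowThree)
    (hC : Sig.stub_offLocusRest) :
    Summit.BirchSwinnertonDyer.BirchSwinnertonDyer.Theses.SignedLowerHalves.KobayashiLowerHalfLargeImage := by
  intro W _ _ p _ hp hX hcm hap hs
  by_cases hloc : OnFwLocus W p
  · exact hA W p hp hX hcm hap hs hloc
  · by_cases hsh : p = 3 ∧ HasShadow W ∧ Assumption34TateAt 3 W
    · obtain ⟨hp3, hq, h34⟩ := hsh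
      subst hp3
      exact hB W hX hcm hap hs hq h34
    · exact hC W p hp hX hcm hap hs hloc hsh

/-- The crux from the three registered-shape stubs (sorries upstream in the stubs only). -/
theorem KobayashiLowerHalfLargeImage_holds_of_stubs :
    Summit.BirchSwinnertonDyer.BirchSwinnertonDyer.Theses.SignedLowerHalves.KobayashiLowerHalfLargeImage :=
  KobayashiLowerHalfLargeImage_of stub_fwLocus stub_shadowThree stub_offLocusRest

end ShadowSeed

end Summit.BirchSwinnertonDyer.BirchSwinnertonDyer.Cruxes.KobayashiLowerHalfLargeImage

end
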